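import Summits.ResolutionOfSingularities.ResolutionOfSingularities.Theorems.PurelyInseparableDim4ResConeShadeTwoFrameLemmas
import Summits.ResolutionOfSingularities.ResolutionOfSingularities.Theorems.PurelyInseparableDim4ResConeShadeTwoSwitchLocal
import Summits.ResolutionOfSingularities.ResolutionOfSingularities.Theorems.PurelyInseparableDim4ResConeShadeTwoResidue
import Summits.ResolutionOfSingularities.ResolutionOfSingularities.Theorems.PurelyInseparableDim4FreeTailLemma
import HarnessLib
import HarnessLib.Audit.Tags

/-!
# Purely inseparable four-folds — K2(p), PHASE `d = 2`, PART XI: the FRAME-WINDOW TRANSFER — light switches die within four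
# steps; the located residue swaps its free letter infinitely often (every prime)

[OURS · counted 0 · cell `res-dim4-pi` · seat res-dim4-p-7 g3 · K2(p) lane (holder res-dim4-p-12 lineage; desk WORDs #82 (c),
#96 (a)); frame infrastructure res-dim4-p-11 g3 / res-dim4-p-1 g3; hand analysis res-dim4-idea-4 (I-4-6 (C3-2L), I-4-7 (TS)).]
Nothing here proves K2(p), `NoIsolatedTrap p p`, or resolution of singularities in dimension ≥ 4 / characteristic `p`.  AI kernel
work, weaker than expert review.

The located `d = 2` residue (`shadeTwo_located`) is an α-tail on the ledger `{p − 3, 1, 1, 0}`: a heavy letter `x`, two light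
letters, a free letter `f` with `x_f² ∈ supp g`; its steps are taken in a light chart (translating `f` only, by the forced amount)
or in the chart of `f` itself (a SWAP of the free letter).
* `exists_straight_frame`: at a presented state with `f` free and `g_{ff} ≠ 0` (`2 ≠ 0` in `K`) there is an admissible datum
  `φ = ℓ + φ₂` (first-order frame of PART X, then p-1's Tschirnhaus jet `exists_tsch_jet`, `d = 2`) such that `tsch f φ F` has
  NO monomial `x^r u^m x_f` with `|m| ≤ N`.
* **`no_light_switch_window`**: a swap-free window `t, …, t + 5` of the α-tail that starts with a light SWITCH (`j t = u`,
  `j (t+1) = v ≠ u`) is impossible: re-frame `c t` straight to order `7`, push the frame along the window with p-11's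
  `step_cleanTsch` — the MATCHING LEMMA makes every pushed step a CORNER step over the honest translated one, straightness
  drops by one per step (`exists_source_of_corner`) and keeps the matching alive for five steps — and the six frame states are
  an honest local corner window killed by PART IX (`no_corner_switch_window_local`).
* **`shadeTwo_swaps_recur`** (THE LOCATED `d = 2` RESIDUE, v2): an isolated shade-`2` trap takes the chart of its FREE
  contact letter infinitely often (`(c k).r (j k) = 0` beyond every index) — by the free-tail lemma (p-typ/p-lit FT,
  `noIsolatedFreeTailAt_self`) satellites recur, a swap-free satellite is a light switch, and light switches die.
What is NOT here: the swap steps themselves (the two chart presentations of one closed point differ by a non-polynomial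
local isomorphism; no tree notion yet) — the remaining `d = 2` residue is «infinitely many swaps».
bears_on: LADDER-RESOLUTION:D157-DOOR2 (res-dim4-pi · K2(p) · phase d = 2).  Supports stmt-ResolutionOfSingularities-16155
(helper).
-/

set_option linter.dupNamespace false -- mandated namespace of this single-conjunct summit

noncomputable section

namespace Summit.ResolutionOfSingularities.ResolutionOfSingularities.Theorems.PIDim4

namespace ResCone

open MvPolynomial Finset
open Literature.AlgebraicGeometry.Resolution
open Literature.AlgebraicGeometry.Resolution.CentreBlowup
open Literature.AlgebraicGeometry.Resolution.Hauser2010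
open Literature.AlgebraicGeometry.Resolution.HauserPerlega2019
open FrameChange
open PointBlowup (translate)

variable {K : Type} [Field K] [DecidableEq K]

/-! ## §1 A frame straight to finite order at one state -/

omit [DecidableEq K] in
/-- **A STRAIGHT FRAME TO ORDER `N`**: at a presented state with `x^r ∣ F`, `ord₀ F = |r| + 2`, a free letter `f` (`r_f = 0`)
and `g_{ff} ≠ 0` (`2 ≠ 0` in `K`), some admissible `φ` (`φ(0) = 0`, `f ∉ vars φ`) makes `tsch f φ F` free of every monomial
`x^r · n` with `n_f = 1` and `|n| ≤ N + 1` — the first-order frame of PART X followed by the Tschirnhaus jet at `d = 2`.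
[cite: Abhyankar1990, Lecture 25 pp. 216–217] [folklore] -/
theorem exists_straight_frame {s : State K} {W : ℕ} (hW : s.r.degree = W) (ho : ordZero s.F = ((W + 2 : ℕ) : ℕ∞))
    (hr : ∀ e ∈ s.F.support, s.r ≤ e) {f : Fin 4} (hrf : s.r f = 0)
    (hsq : coeff (Finsupp.single f 2) (resForm s) ≠ 0) (h2 : (2 : K) ≠ 0) (N : ℕ) :
    ∃ φ : MvPolynomial (Fin 4) K, constantCoeff φ = 0 ∧ f ∉ φ.vars ∧
      ∀ n : Fin 4 →₀ ℕ, s.r + n ∈ (tsch f φ s.F).support → n f = 1 → N + 2 ≤ n.degree := by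
  classical
  obtain ⟨cl, hcf, hmix, hsql⟩ := exists_firstOrderFrame f (resForm s) hsq h2
  have hlv : f ∉ (∑ i, C (cl i) * X i : MvPolynomial (Fin 4) K).vars := not_mem_vars_linear hcf
  have hl1 := isHomogeneous_linear (K := K) cl
  have hl0 := constantCoeff_eq_zero_of_isHomogeneous_one hl1
  -- the linearly re-framed state
  have hF₁ : tsch f (∑ i, C (cl i) * X i) s.F = monomial s.r 1 * tsch f (∑ i, C (cl i) * X i) (s.F.divMonomial s.r) := by
    conv_lhs => rw [eq_monomial_mul_divMonomial hr]
    rw [tsch_monomial_mul _ hrf]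
  have ho₁ : ordZero (tsch f (∑ i, C (cl i) * X i) s.F) = ((W + 2 : ℕ) : ℕ∞) := (ordZero_tsch hlv hl0 s.F).trans ho
  have hcoeff : ∀ m : Fin 4 →₀ ℕ, m.degree = 2 →
      coeff m (tsch f (∑ i, C (cl i) * X i) (s.F.divMonomial s.r)) = coeff m (tsch f (∑ i, C (cl i) * X i) (resForm s)) := by
    intro m hm
    rw [← resForm_tschState_of_isHomogeneous_one hlv hl1 hrf hr,
      coeff_resForm_eq_coeff_add (s := ⟨tsch f (∑ i, C (cl i) * X i) s.F, s.r, s.exc⟩) ho₁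
        (by change m.degree = W + 2 - s.r.degree; omega) (by change s.r.degree ≤ W + 2; omega)]
    change _ = coeff (s.r + m) (tsch f (∑ i, C (cl i) * X i) s.F)
    rw [hF₁, coeff_monomial_mul, one_mul]
  -- the jet hypotheses at `d = 2`
  have hc2 : coeff (Finsupp.single f 2) (tsch f (∑ i, C (cl i) * X i) (s.F.divMonomial s.r)) ≠ 0 := by
    rw [hcoeff _ (Finsupp.degree_single f 2), hsql]; exact hsq
  have hG : ∀ m : Fin 4 →₀ ℕ, m f = 0 → m.degree ≤ 1 →
      coeff (m + Finsupp.single f (2 - 1)) (tsch f (∑ i, C (cl i) * X i) (s.F.divMonomial s.r)) = 0 := by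
    intro m hmf hm
    change coeff (m + Finsupp.single f 1) _ = 0
    rcases eq_zero_or_eq_single_of_degree_le_one hm with rfl | ⟨i, rfl⟩
    · have h : coeff (s.r + Finsupp.single f 1) (tsch f (∑ i, C (cl i) * X i) s.F) = 0 := by
        apply coeff_eq_zero_of_degree_lt_ordZero
        rw [ho₁, map_add, Finsupp.degree_single, hW]
        exact_mod_cast (by omega : W + 1 < W + 2)
      rw [hF₁, coeff_monomial_mul, one_mul] at h
      simpa only [zero_add] using h
    · have hif : i ≠ f := by
        rintro rfl
        rw [Finsupp.single_eq_same] at hmf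
        exact one_ne_zero hmf
      rw [hcoeff _ (by rw [map_add, Finsupp.degree_single, Finsupp.degree_single]), hmix i hif]
  have h2' : ((2 : ℕ) : K) ≠ 0 := by rw [Nat.cast_ofNat]; exact h2
  obtain ⟨φ₂, h0₂, hφ₂, -, hjet⟩ := exists_tsch_jet f (d := 2) (by norm_num) h2' _ hc2 hG N
  refine ⟨(∑ i, C (cl i) * X i) + φ₂, by rw [map_add, hl0, h0₂, add_zero], fun h => ?_, fun n hn hnf => ?_⟩
  · rcases Finset.mem_union.mp (MvPolynomial.vars_add_subset _ _ h) with h | h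
    · exact hlv h
    · exact hφ₂ h
  · rw [← tsch_comp_tsch φ₂ hlv, AlgHom.comp_apply, hF₁, tsch_monomial_mul φ₂ hrf, MvPolynomial.mem_support_iff,
      coeff_monomial_mul, one_mul] at hn
    by_contra hlt
    exact hn (hjet n hnf (by change n.degree ≤ N + 1; omega))

/-! ## §2 The frame-window transfer: light switches die -/

section Window

variable {p : ℕ} [hp : Fact p.Prime] {c : ℕ → State K} {j : ℕ → Fin 4} {b : ℕ → Fin 4 → K}

/-- **LIGHT SWITCHES DIE WITHIN FOUR STEPS.**  Along an isolated shade-`2` chain with `x^{r₀} ∣ F₀`, a window `t, …, t + 5`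
(`t ≥ 1`) on the ledger `W = p − 1` with a letter `f` free throughout, `x_f²` in the quadric at `t, …, t + 4`, translations
supported on `f`, charts `j t = u`, `j (t+1) = v` (`u ≠ v`, both `≠ f`), `j (t+2), j (t+3), j (t+4) ∈ {u, v}`, `v` light at
`t + 1`, `u` light at `t + 2` — is impossible (`p ≥ 5`): a Tschirnhaus frame straight to order `7` at `c t`, pushed along the
window, presents it as an honest LOCAL CORNER WINDOW (`…SwitchLocal.no_corner_switch_window_local`).
[OURS · K2(p) phase d = 2] [cite: Hauser2010, §§F–G] [folklore] -/
theorem no_light_switch_window [CharP K p] (hw : FreeTail.IsWitnessedChain p c j b)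
    (hc : ∀ k, IsIsolated p (c k).F ∧ Step0 p (c k) (c (k + 1)) ∧ ordZero (c k).F ≠ p ∧ (c k).shade = 2)
    (hr0 : ∀ e ∈ (c 0).F.support, (c 0).r ≤ e) (h5 : 5 ≤ p) {t : ℕ} (ht : 1 ≤ t) {f u v : Fin 4}
    (huv : u ≠ v) (huf : u ≠ f) (hvf : v ≠ f)
    (hW : ∀ i, i ≤ 5 → (c (t + i)).r.degree + 1 = p) (hrf : ∀ i, i ≤ 5 → (c (t + i)).r f = 0)
    (hsq : ∀ i, i ≤ 4 → coeff (Finsupp.single f 2) (resForm (c (t + i))) ≠ 0)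
    (hb : ∀ i, i ≤ 4 → ∀ i', i' ≠ f → b (t + i) i' = 0)
    (hrv1 : (c (t + 1)).r v = 1) (hru2 : (c (t + 2)).r u = 1)
    (hju : j t = u) (hjv : j (t + 1) = v) (hj2 : j (t + 2) = u ∨ j (t + 2) = v)
    (hj3 : j (t + 3) = u ∨ j (t + 3) = v) (hj4 : j (t + 4) = u ∨ j (t + 4) = v) : False := by
  classical
  -- constants
  have h2 : (2 : K) ≠ 0 := by
    intro h
    have h' : ((2 : ℕ) : K) = 0 := by rw [Nat.cast_ofNat]; exact h
    rw [CharP.cast_eq_zero_iff K p] at h'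
    have := Nat.le_of_dvd (by norm_num) h'
    omega
  have hjf : ∀ i, i ≤ 4 → j (t + i) ≠ f := by
    intro i hi
    interval_cases i
    · rw [Nat.add_zero, hju]; exact huf
    · rw [hjv]; exact hvf
    · rcases hj2 with h | h <;> rw [h]
      exacts [huf, hvf]
    · rcases hj3 with h | h <;> rw [h]
      exacts [huf, hvf]
    · rcases hj4 with h | h <;> rw [h]
      exacts [huf, hvf]
  have hpo : ∀ i, i ≤ 5 → ¬ p ∣ (c (t + i)).r.degree + 2 := by
    intro i hi hdvd
    rw [show (c (t + i)).r.degree + 2 = p + 1 by have := hW i hi; omega, Nat.dvd_add_right (dvd_refl p),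
      Nat.dvd_one] at hdvd
    exact hp.out.one_lt.ne' hdvd
  have hclean : ∀ i, deletePthPowers p (c (t + i)).F = (c (t + i)).F := by
    intro i
    obtain ⟨t', rfl⟩ : ∃ t', t = t' + 1 := ⟨t - 1, by omega⟩
    rw [show t' + 1 + i = t' + i + 1 by omega, (hw (t' + i)).2.2.2.2]
    exact deletePthPowers_step_F p _ _ _ _
  have hfact := fun i => chain_step hw hc hr0 (t + i)
  -- §1: the straight frame at `c t`
  obtain ⟨-, -, -, hr_t, ho_t, -⟩ := hfact 0
  obtain ⟨φ₀, h00, hφ0, hstr0⟩ :=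
    exists_straight_frame (s := c (t + 0)) rfl ho_t hr_t (hrf 0 (by norm_num)) (hsq 0 (by norm_num)) h2 5
  -- the data: pushed frames and the frame states
  let φ : ℕ → MvPolynomial (Fin 4) K := fun i => Nat.rec φ₀ (fun i ψ =>
    translate (0 : Fin 4 → K) (chartTransform 1 Finset.univ (j (t + i)) ψ) -
      C (MvPolynomial.eval (0 : Fin 4 → K) (chartTransform 1 Finset.univ (j (t + i)) ψ))) i
  have hφs : ∀ i, φ (i + 1) = translate (0 : Fin 4 → K) (chartTransform 1 Finset.univ (j (t + i)) (φ i)) -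
      C (MvPolynomial.eval (0 : Fin 4 → K) (chartTransform 1 Finset.univ (j (t + i)) (φ i))) := fun i => rfl
  let S : ℕ → State K := fun i => Nat.rec
    (⟨deletePthPowers p (tsch f φ₀ (c (t + 0)).F), (c (t + 0)).r, (c (t + 0)).exc⟩ : State K)
    (fun i s => CentreBlowup.step p Finset.univ (j (t + i)) (0 : Fin 4 → K) s) i
  have hSs : ∀ i, S (i + 1) = CentreBlowup.step p Finset.univ (j (t + i)) (0 : Fin 4 → K) (S i) := fun i => rfl
  -- admissibility of the pushed frames on the window
  have hadm : ∀ i, i ≤ 5 → f ∉ (φ i).vars ∧ constantCoeff (φ i) = 0 := by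
    intro i hi
    induction i with
    | zero => exact ⟨hφ0, h00⟩
    | succ i ih =>
      have ih' := ih (by omega)
      rw [hφs]
      exact ⟨not_mem_vars_tschShift (not_mem_vars_chartTransform 1 _ (hjf i (by omega)) ih'.1) _,
        constantCoeff_tschShift _ _⟩
  -- THE INVARIANT: the frame states sit over the honest ones, straight to order `7 − i`
  have key : ∀ i, i ≤ 5 → (S i).F = deletePthPowers p (tsch f (φ i) (c (t + i)).F) ∧ (S i).r = (c (t + i)).r ∧
      ∀ n : Fin 4 →₀ ℕ, (c (t + i)).r + n ∈ ((S i).F).support → n f = 1 → (5 - i) + 2 ≤ n.degree := by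
    intro i hi
    induction i with
    | zero =>
      refine ⟨rfl, rfl, fun n hn hnf => ?_⟩
      exact hstr0 n (MohAlong.mem_support_of_mem_support_deletePthPowers p hn).1 hnf
    | succ i ih =>
      obtain ⟨hFi, hri, hStr⟩ := ih (by omega)
      have hi4 : i ≤ 4 := by omega
      obtain ⟨hψ, h0⟩ := hadm i (by omega)
      obtain ⟨hck, hbj, heq, hr_s, ho_s, hpW, hW2, -⟩ := hfact i
      have hq_s : (p : ℕ∞) ≤ ordZero (c (t + i)).F := by
        rw [ho_s]; exact_mod_cast (show p ≤ (c (t + i)).r.degree + 2 by omega)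
      -- MATCHING: the frame's translation in the chart `j (t+i)` is the honest one
      have hmatch : MvPolynomial.eval (0 : Fin 4 → K) (chartTransform 1 Finset.univ (j (t + i)) (φ i)) = b (t + i) f := by
        refine frame_translation_eq p rfl ho_s hr_s hpW hW2 (hpo i (by omega)) (hrf i (by omega)) (hsq i hi4) h2
          (hjf i hi4) hbj (hb i hi4) heq h0 hψ ?_
        by_contra hne
        have hmem : (c (t + i)).r + (Finsupp.single (j (t + i)) 1 + Finsupp.single f 1) ∈ ((S i).F).support := by
          rw [hFi]; exact MvPolynomial.mem_support_iff.mpr hne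
        have h := hStr _ hmem
          (by rw [Finsupp.add_apply, Finsupp.single_apply, if_neg (hjf i hi4), Finsupp.single_eq_same])
        rw [map_add, Finsupp.degree_single, Finsupp.degree_single] at h
        omega
      have hbplus : Function.update (0 : Fin 4 → K) f ((0 : Fin 4 → K) f +
          MvPolynomial.eval (0 : Fin 4 → K) (chartTransform 1 Finset.univ (j (t + i)) (φ i))) = b (t + i) := by
        funext i'
        by_cases hi' : i' = f
        · rw [hi', Function.update_self, Pi.zero_apply, zero_add, hmatch]
        · rw [Function.update_of_ne hi', Pi.zero_apply, hb i hi4 i' hi']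
      -- the pushed frame state sits over `c (t+i+1)`
      have hF' : (S (i + 1)).F = deletePthPowers p (tsch f (φ (i + 1)) (c (t + (i + 1))).F) := by
        rw [hSs, hφs, step_F_of_cleanTsch p hFi hq_s (hjf i hi4) h0 0, hbplus, ← hck, add_assoc]
      have hr' : (S (i + 1)).r = (c (t + (i + 1))).r := by
        rw [hSs, step_r_of_cleanTsch p hFi hri (hclean i) hψ h0 (hrf i (by omega)) (j (t + i)) 0, hbplus, ← hck, add_assoc]
      refine ⟨hF', hr', fun n' hn' hn'f => ?_⟩
      -- straightness drops by at most one under the frame's corner step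
      have hW_i : (S i).r.degree = (c (t + i)).r.degree := by rw [hri]
      have ho_i : ordZero (S i).F = (((c (t + i)).r.degree + 2 : ℕ) : ℕ∞) := by
        rw [hFi, ordZero_clean_tsch p hψ h0 (hclean i), ho_s]
      have hr_i : ∀ e ∈ ((S i).F).support, (S i).r ≤ e := by
        rw [hFi, hri]; exact forall_le_of_mem_support_clean_tsch p (hrf i (by omega)) hr_s
      have hm' : (CentreBlowup.step p Finset.univ (j (t + i)) (0 : Fin 4 → K) (S i)).r + n' ∈
          (CentreBlowup.step p Finset.univ (j (t + i)) (0 : Fin 4 → K) (S i)).F.support := by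
        rw [← hSs, hr']; exact hn'
      obtain ⟨n, hn, h2n, hn'eq⟩ := exists_source_of_corner (p := p) (j (t + i)) (S i) hW_i ho_i hr_i (by omega) hm'
      rw [hri] at hn
      obtain ⟨-, hnoff⟩ := apply_of_eq_update hn'eq
      have hnf : n f = 1 := by rw [← hnoff f (hjf i hi4).symm]; exact hn'f
      have hdeg := hStr n hn hnf
      have hdeg' := degree_update_add n (j (t + i)) (n.degree - 2)
      rw [← hn'eq] at hdeg'
      have hle := apply_add_apply_le_degree n (hjf i hi4)
      omega
  -- the six frame states are an honest local corner window
  have hS : ∀ i, i ≤ 5 → IsIsolated p (S i).F ∧ (∀ e ∈ (S i).F.support, (S i).r ≤ e) ∧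
      ordZero (S i).F = (((S i).r.degree + 2 : ℕ) : ℕ∞) ∧ p ≤ (S i).r.degree + 1 ∧ (S i).r.degree + 4 ≤ 2 * p ∧
      (S i).shade = 2 := by
    intro i hi
    obtain ⟨hFi, hri, -⟩ := key i hi
    obtain ⟨hψ, h0⟩ := hadm i hi
    obtain ⟨-, -, -, hr_s, ho_s, hpW, hW2, -⟩ := hfact i
    have ho_i : ordZero (S i).F = (((c (t + i)).r.degree + 2 : ℕ) : ℕ∞) := by
      rw [hFi, ordZero_clean_tsch p hψ h0 (hclean i), ho_s]
    refine ⟨?_, ?_, ?_, ?_, ?_, ?_⟩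
    · rw [hFi]; exact (isIsolated_clean_tsch_iff p hψ h0 _).mpr (hc (t + i)).1
    · rw [hFi, hri]; exact forall_le_of_mem_support_clean_tsch p (hrf i hi) hr_s
    · rw [ho_i, hri]
    · rw [hri]; exact hpW
    · rw [hri]; exact hW2
    · have h := (hc (t + i)).2.2.2
      unfold CState.shade at h ⊢
      rw [ho_i, hri, ← ho_s]
      exact h
  have hT : ∀ i, i ≤ 4 → S (i + 1) = CentreBlowup.step p Finset.univ (j (t + i)) (0 : Fin 4 → K) (S i) :=
    fun i _ => hSs i
  have hr1 : (S 1).r = (c (t + 1)).r := (key 1 (by norm_num)).2.1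
  have hr2 : (S 2).r = (c (t + 2)).r := (key 2 (by norm_num)).2.1
  exact no_corner_switch_window_local (s := S) (j := fun i => j (t + i)) hS hT huv
    (by rw [hr1]; exact hW 1 (by norm_num)) (by rw [hr2]; exact hW 2 (by norm_num))
    (by rw [hr1]; exact hrv1) (by rw [hr2]; exact hru2) hju hjv hj2 hj3 hj4

/-! ## §3 The located residue swaps its free letter infinitely often -/

/-- **THE LOCATED `d = 2` RESIDUE, v2 — SWAPS RECUR.**  Along an isolated shade-`2` `Step0` chain with `x^{r₀} ∣ F₀` (every
prime; such a chain forces `p ≥ 5` and the ledger `{p − 3, 1, 1, 0}`, PART VII), the chart letter is the FREE letter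
infinitely often: `(c k).r (j k) = 0` beyond every index.  (FT gives satellites; a satellite avoiding the free letter is a
light switch; light switches die within four swap-free steps, `no_light_switch_window`.) [OURS · K2(p) phase d = 2]
[folklore] -/
theorem shadeTwo_swaps_recur [CharP K p] (hw : FreeTail.IsWitnessedChain p c j b)
    (hc : ∀ k, IsIsolated p (c k).F ∧ Step0 p (c k) (c (k + 1)) ∧ ordZero (c k).F ≠ p ∧ (c k).shade = 2)
    (hr0 : ∀ e ∈ (c 0).F.support, (c 0).r ≤ e) (k₀ : ℕ) : ∃ k, k₀ ≤ k ∧ (c k).r (j k) = 0 := by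
  classical
  by_contra hno
  push Not at hno
  obtain ⟨k₁, x, h5, hloc⟩ := shadeTwo_located hw hc hr0
  -- a satellite step beyond `max k₀ k₁ + 1` (the free-tail lemma)
  obtain ⟨t, ht, hsat⟩ : ∃ t, max k₀ k₁ + 1 ≤ t ∧ FreeTail.IsSatellite j b t := by
    by_contra h
    push Not at h
    obtain ⟨k, hk⟩ := FreeTailProof.noIsolatedFreeTailAt_self p K c j b (max k₀ k₁ + 1) hw h
    exact hk (hc k).1
  have ht0 : ∀ i, k₀ ≤ t + i := fun i => by have := le_max_left k₀ k₁; omega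
  have ht1 : ∀ i, k₁ ≤ t + i := fun i => by have := le_max_right k₀ k₁; omega
  -- the free letter at `t`
  obtain ⟨hWt, hxt, hjt, -, f, hfx, hrft, -, -⟩ := hloc t (ht1 0)
  -- it stays free (no swap), and is THE free letter of every later state
  have hfree : ∀ i, (c (t + i)).r f = 0 := by
    intro i
    induction i with
    | zero => exact hrft
    | succ i ih =>
      have hjf : j (t + i) ≠ f := fun h => hno (t + i) (ht0 i) (by rw [h]; exact ih)
      rw [← add_assoc, (hw (t + i)).2.2.2.2]
      exact step_r_apply_eq_zero ih hjf _
  have huniq : ∀ i (g : Fin 4), (c (t + i)).r g = 0 → g = f := by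
    intro i g hg
    obtain ⟨-, hx, -, -, f', -, hf', -, hones⟩ := hloc (t + i) (ht1 i)
    have hgx : g ≠ x := fun h => by rw [h] at hg; omega
    have hgf' : g = f' := by
      by_contra h
      have := hones g hgx h
      omega
    have hff' : f = f' := by
      by_contra h
      have hfx' : f ≠ x := fun h' => by have := hfree i; rw [h'] at this; omega
      have := hones f hfx' h
      have := hfree i
      omega
    rw [hgf', hff']
  have hjf : ∀ i, j (t + i) ≠ f := fun i h => hno (t + i) (ht0 i) (by rw [h]; exact hfree i)
  have hjx : ∀ i, j (t + i) ≠ x := by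
    intro i h
    obtain ⟨-, hx, hj1, -⟩ := hloc (t + i) (ht1 i)
    rw [h] at hj1
    omega
  -- the two light letters
  have hux : j t ≠ x := hjx 0
  have hvx : j (t + 1) ≠ x := hjx 1
  have huf : j t ≠ f := hjf 0
  have hvf : j (t + 1) ≠ f := hjf 1
  have huv : j t ≠ j (t + 1) := fun h => hsat.1 h.symm
  have hlight : ∀ i, j (t + i) = j t ∨ j (t + i) = j (t + 1) := by
    intro i
    by_cases h : j (t + i) = j t
    · exact Or.inl h
    · exact Or.inr (fin4_eq_of_forall_ne hfx.symm hux.symm huf.symm ⟨hjx i, hjf i, h⟩ ⟨hvx, hvf, huv.symm⟩)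
  -- the window hypotheses
  refine no_light_switch_window hw hc hr0 h5 (t := t) (by omega) huv huf hvf
    (fun i _ => (hloc (t + i) (ht1 i)).1) (fun i _ => hfree i) (fun i _ => ?_) (fun i _ i' hi' => ?_) ?_ ?_ rfl rfl
    (hlight 2) (hlight 3) (hlight 4)
  · -- `x_f²` sits in the quadric
    obtain ⟨-, -, -, -, f', -, hf', hsq', -⟩ := hloc (t + i) (ht1 i)
    rw [huniq i f' hf'] at hsq'
    exact hsq'
  · -- translations are supported on `f`
    by_contra hne
    have h := (translated_step hw hc hr0 (t + i) hne).2.2.1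
    rw [add_assoc] at h
    exact hi' (huniq (i + 1) i' h)
  · -- `v` is light at `t + 1`
    obtain ⟨-, -, hj1, -⟩ := hloc (t + 1) (ht1 1)
    have := hno (t + 1) (ht0 1)
    omega
  · -- `u` is light at `t + 2`
    obtain ⟨-, -, -, -, f', -, hf', -, hones⟩ := hloc (t + 2) (ht1 2)
    exact hones (j t) hux (by rw [huniq 2 f' hf']; exact huf)

end Window

end ResCone

end Summit.ResolutionOfSingularities.ResolutionOfSingularities.Theorems.PIDim4

end
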